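import Literature.AnabelianGeometry.EtaleTheta.TemperedFrobenioidToyDegreeSwap
import HarnessLib

/-!
# [EtTh] Cor. 3.8, proof row `Cor38Hyp.PreservesLinear` (F-2815): the bare universal closure is FALSE —
# the degree ↔ base-index swap over the FSM-type base `B(ℤ ⋊ ℕ≥1)` (kernel certificate)

S. Mochizuki, *The étale theta function and its Frobenioid-theoretic manifestations*, Publ. RIMS **45** (2009)
[MochizukiEtTh2009], Cor. 3.8, proof, PDF p. 81 l. 5–8: "`Ψ` preserves … [cf. [Mzk17], Theorem 3.4, (iii)]" — row
`Cor38Hyp.PreservesLinear` of abc-iut-w5-d124's sub-DAG `TemperedFrobenioidCor38Sub.lean` ("`Ψ`, `Ψ⁻¹` carry linear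
morphisms (`deg_Fr = 1`) to linear morphisms") [cite: MochizukiEtTh2009, Cor 3.8 p.81]; S. Mochizuki, *The geometry
of Frobenioids I*, Kyushu J. Math. **62** (2008), Thm. 3.4 (iii) p. 62, Examples 3.8–3.10 pp. 71–72 (self-equivalences
over NON-Frobenius-slim bases) [cite: MochizukiFrdI2008, Thm. 3.4 (iii) p.62].

abc-iut cell, block F, seat abc-iut-w6-d020 (gen 5), FACT-LIST row **F-2815**, CLOSURE side (cell rule R5).  The
INSTANCE form print uses is in the tree (`Cor38Hyp.preservesLinear_treeCatVocab_of_isMonoidOn`, abc-iut-f-001: canonical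
[FrdI] vocabulary, from `FrdI.Thm34ii_holds`, modulo `hBmon_i`).  The typed row is parametrised by an ARBITRARY record
`h : Cor38Hyp C₁ C₂` (any equivalence `Ψ` of the categories of two typed tempered Frobenioids over FSMFF-type bases,
free [FrdI] vocabularies); the tree's certificates for the sibling rows (`UnitToy.hypShift`, `DegreeTwist.hyp` = [FrdI]
Ex. 3.10, `TwoPrimes.hyp`) and [FrdI] Ex. 3.8/3.9 all FIX the arrows of Frobenius degree `1`.  Certificate (an INDEPENDENT
second realisation of the degree ↔ base-index swap; data file `TemperedFrobenioidToyDegreeSwap.lean`):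

* base `D = D₀ := B(M)`, `M := ℤ ⋊ ℕ≥1` (`(u₂,n₂)·(u₁,n₁) = (u₂ + n₂u₁, n₂n₁)`): connected, totally epimorphic, of
  FSM-type — an FSM-morphism `(u,n)` is fiberwise surjective against `(u+1,n)` only if `n ∣ 1`, so FSM-morphisms are
  units (`isOfFSMType`); NOT a groupoid;
* `Λ = ℚ` data: `Φ = Φ^{ℝ-log} = ℚ≥0` (ℚ-monoprime), pulled back along `(u,n)` by `w ↦ w/n`; `B₀^Λ = ℤ × (ℚ≥0)^gp`
  (units `K = ℤ` with divisor `0`), `Div = pr₂`, `ℝ·Φ₀^cnst =` everything, trivial vocabularies (`DegreeSwap.C`);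
* every object of the model Frobenioid is isomorphic to the Frobenius-trivial `X₀ = (•, 0)`, whose endomorphisms are
  `(m, (u,n), k, w)` with laws `m₁m₂`, `(u₂+n₂u₁, n₁n₂)`, `k₂+m₂k₁`, `w₂/n₁+m₂w₁`; the **degree ↔ base-index swap**
  `θ(m,(u,n),k,w) := (n,(k,m),u,w·n/m)` respects these laws, realised as the functor `swap : C ⥤ C` (all objects to
  `X₀`), full, faithful, essentially surjective — an equivalence; `hyp : Cor38Hyp C C`;
* `swap` sends the LINEAR arrow `(1,(0,2),0,0)` of `X₀` to an arrow of Frobenius degree `2`: **`not_preservesLinear`** —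
  so the universal closure of F-2815 is false; the closure theorem OF RECORD is abc-iut-f-133's
  `Cor38Hyp.not_forall_preservesLinear` (p455772, landed first with the same mechanism as an identity-on-objects involution;
  not restated here).  `swap` also moves `O^▷(X₀)` (`not_preservesOTri`, a further witness for F-2812 — abc-iut-f-023's
  [FrdI] Ex. 3.9 certificate is the one of record), while it preserves pre-steps and primary steps (F-2809/F-2810 untouched).

Reading (R5): F-2815 is admissible ONLY as its instance forms; the gap is a SCHEMA gap of the typed interface (`Cor38Hyp`
carries none of the standard-type / slimness hypotheses of [FrdI] Thm. 3.4), not a claim about Cor. 3.8 or Thm. 3.4 as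
printed.  HONEST FRAMING: refereed pre-IUT material; nothing here bears on the disputed [IUTchIII] Cor. 3.12; no side
taken; typed ≠ proved.
-/

noncomputable section

namespace Literature.AnabelianGeometry.EtaleTheta

open CategoryTheory Opposite Literature.AlgebraicGeometry.Frobenioids

namespace DegreeSwap

/-- The divisor law behind the functoriality of the swap: `θ` turns `w₂/n₁ + m₂w₁` into itself. [folklore] -/
private theorem w_law (a b : ℚ≥0) (nφ nψ dφ dψ : ℕ+) :
    ((((nφ : ℕ) : ℚ≥0))⁻¹ * b + ((dψ : ℕ) : ℚ≥0) * a) * (((nψ * nφ : ℕ+) : ℕ) : ℚ≥0) / (((dψ * dφ : ℕ+) : ℕ) : ℚ≥0) =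
      (((dφ : ℕ) : ℚ≥0))⁻¹ * (b * ((nψ : ℕ) : ℚ≥0) / ((dψ : ℕ) : ℚ≥0)) +
        ((nψ : ℕ) : ℚ≥0) * (a * ((nφ : ℕ) : ℚ≥0) / ((dφ : ℕ) : ℚ≥0)) := by
  have h1 : ((nφ : ℕ) : ℚ≥0) ≠ 0 := by positivity
  have h2 : ((nψ : ℕ) : ℚ≥0) ≠ 0 := by positivity
  have h3 : ((dφ : ℕ) : ℚ≥0) ≠ 0 := by positivity
  have h4 : ((dψ : ℕ) : ℚ≥0) ≠ 0 := by positivity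
  push_cast
  field_simp

/-! ### §1  The swap functor `θ(m,(u,n),k,w) = (n,(k,m),u,w·n/m)` and the record `hyp : Cor38Hyp C C` -/

/-- **The degree ↔ base-index swap** `θ(m,(u,n),k,w) := (n,(k,m),u,w·n/m)` as a functor `C ⥤ C` collapsing every
object onto `X₀` (all objects are isomorphic to `X₀`). [cite: MochizukiFrdI2008, Thm. 3.4 (iii) p.62] -/
def swap : C.category ⥤ C.category where
  obj _ := X₀
  map φ := mkEnd (M.n (ModelFrobenioid.baseMap φ)) ⟨kOf φ, ModelFrobenioid.degFr φ⟩
    (wOf φ * ((M.n (ModelFrobenioid.baseMap φ) : ℕ) : ℚ≥0) / ((ModelFrobenioid.degFr φ : ℕ) : ℚ≥0))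
    (M.u (ModelFrobenioid.baseMap φ))
  map_id X := by
    change mkEnd 1 ⟨kOf (𝟙 X), 1⟩ (wOf (𝟙 X) * (((1 : ℕ+) : ℕ) : ℚ≥0) / (((1 : ℕ+) : ℕ) : ℚ≥0)) 0 = 𝟙 X₀
    rw [show kOf (𝟙 X) = 0 from rfl, show wOf (𝟙 X) = 0 from rfl, zero_mul, zero_div]
    exact mkEnd_one
  map_comp {X Y Z} φ ψ := by
    rw [mkEnd_comp]
    refine mkEnd_congr rfl (M.ext (kOf_comp φ ψ) rfl) ?_ rfl
    rw [wOf_comp]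
    exact w_law (wOf φ) (wOf ψ) (M.n (ModelFrobenioid.baseMap φ)) (M.n (ModelFrobenioid.baseMap ψ))
      (ModelFrobenioid.degFr φ) (ModelFrobenioid.degFr ψ)

/-- `swap` in coordinates. [cite: MochizukiFrdI2008, Thm. 3.4 (iii) p.62] -/
theorem swap_map {X Y : C.category} (φ : X ⟶ Y) :
    swap.map φ = mkEnd (M.n (ModelFrobenioid.baseMap φ)) ⟨kOf φ, ModelFrobenioid.degFr φ⟩
      (wOf φ * ((M.n (ModelFrobenioid.baseMap φ) : ℕ) : ℚ≥0) / ((ModelFrobenioid.degFr φ : ℕ) : ℚ≥0))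
      (M.u (ModelFrobenioid.baseMap φ)) := rfl

/-- Every endomorphism of `X₀` is an `mkEnd`. [cite: MochizukiFrdI2008, Thm. 5.2 (i) p.100] -/
theorem mkEnd_eta (f : X₀ ⟶ X₀) : mkEnd (ModelFrobenioid.degFr f) (ModelFrobenioid.baseMap f) (wOf f) (kOf f) = f := by
  have h2 : (ModelFrobenioid.unit f).1.2 = Algebra.GrothendieckGroup.of (ModelFrobenioid.div f) := by
    have h := unit_snd_eq f
    simp only [X₀_cls, one_pow, one_mul, map_one, inv_one] at h
    exact h
  have h3 : (ModelFrobenioid.unit f).1.1.2 = Algebra.GrothendieckGroup.of ((ModelFrobenioid.div f).1 : W) := by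
    rw [unit_fst_snd_eq, h2]
    exact gpMap_of _ _
  refine ModelFrobenioid.hom_ext rfl rfl (Subtype.ext rfl) (Subtype.ext (Prod.ext (Prod.ext rfl ?_) ?_))
  · exact h3.symm
  · exact h2.symm

/-- The morphism `X ⟶ Y` that `swap` sends to a given endomorphism `f` of `X₀` (`θ` is an involution).
[cite: MochizukiFrdI2008, Thm. 3.4 (iii) p.62] -/
def preim (X Y : C.category) (f : X₀ ⟶ X₀) : X ⟶ Y :=
  homOf X Y (M.n (ModelFrobenioid.baseMap f)) ((⟨kOf f, ModelFrobenioid.degFr f⟩ : M) : X.base ⟶ Y.base)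
    ⟨Multiplicative.ofAdd (wOf f * ((M.n (ModelFrobenioid.baseMap f) : ℕ) : ℚ≥0) / ((ModelFrobenioid.degFr f : ℕ) : ℚ≥0)),
      trivial⟩
    (M.u (ModelFrobenioid.baseMap f))

/-- `swap` is FULL: `swap (preim f) = f`. [cite: MochizukiFrdI2008, Thm. 3.4 (iii) p.62] -/
theorem swap_preim (X Y : C.category) (f : X₀ ⟶ X₀) : swap.map (preim X Y f) = f := by
  have ha : ((M.n (ModelFrobenioid.baseMap f) : ℕ) : ℚ≥0) ≠ 0 := by positivity
  have hb : ((ModelFrobenioid.degFr f : ℕ) : ℚ≥0) ≠ 0 := by positivity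
  have hw : wOf f * ((M.n (ModelFrobenioid.baseMap f) : ℕ) : ℚ≥0) / ((ModelFrobenioid.degFr f : ℕ) : ℚ≥0) *
      ((ModelFrobenioid.degFr f : ℕ) : ℚ≥0) / ((M.n (ModelFrobenioid.baseMap f) : ℕ) : ℚ≥0) = wOf f := by
    field_simp
  calc swap.map (preim X Y f)
      = mkEnd (ModelFrobenioid.degFr f) (ModelFrobenioid.baseMap f)
          (wOf f * ((M.n (ModelFrobenioid.baseMap f) : ℕ) : ℚ≥0) / ((ModelFrobenioid.degFr f : ℕ) : ℚ≥0) *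
            ((ModelFrobenioid.degFr f : ℕ) : ℚ≥0) / ((M.n (ModelFrobenioid.baseMap f) : ℕ) : ℚ≥0)) (kOf f) := rfl
    _ = mkEnd (ModelFrobenioid.degFr f) (ModelFrobenioid.baseMap f) (wOf f) (kOf f) := by rw [hw]
    _ = f := mkEnd_eta f

/-- `swap` is full. [cite: MochizukiFrdI2008, Thm. 3.4 (iii) p.62] -/
instance : swap.Full where
  map_surjective f := ⟨preim _ _ f, swap_preim _ _ f⟩

/-- `swap` is FAITHFUL: the coordinates `(m, (u,n), k, w)` of an arrow can be read off `θ` of them, and an arrow is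
determined by its coordinates (the `Φ^gp`-part of the rational function is fixed by relation (d)).
[cite: MochizukiFrdI2008, Thm. 3.4 (iii) p.62] -/
theorem swap_faithful {X Y : C.category} (φ₁ φ₂ : X ⟶ Y) (h : swap.map φ₁ = swap.map φ₂) : φ₁ = φ₂ := by
  have hn : M.n (ModelFrobenioid.baseMap φ₁) = M.n (ModelFrobenioid.baseMap φ₂) := congrArg ModelFrobenioid.degFr h
  have hb : (⟨kOf φ₁, ModelFrobenioid.degFr φ₁⟩ : M) = ⟨kOf φ₂, ModelFrobenioid.degFr φ₂⟩ :=
    congrArg ModelFrobenioid.baseMap h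
  have hk : kOf φ₁ = kOf φ₂ := congrArg M.u hb
  have hd : ModelFrobenioid.degFr φ₁ = ModelFrobenioid.degFr φ₂ := congrArg M.n hb
  have hu : M.u (ModelFrobenioid.baseMap φ₁) = M.u (ModelFrobenioid.baseMap φ₂) := congrArg kOf h
  have hw' : wOf φ₁ * ((M.n (ModelFrobenioid.baseMap φ₁) : ℕ) : ℚ≥0) / ((ModelFrobenioid.degFr φ₁ : ℕ) : ℚ≥0) =
      wOf φ₂ * ((M.n (ModelFrobenioid.baseMap φ₂) : ℕ) : ℚ≥0) / ((ModelFrobenioid.degFr φ₂ : ℕ) : ℚ≥0) :=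
    congrArg wOf h
  rw [hn, hd, mul_div_assoc, mul_div_assoc] at hw'
  have hq : ((M.n (ModelFrobenioid.baseMap φ₂) : ℕ) : ℚ≥0) / ((ModelFrobenioid.degFr φ₂ : ℕ) : ℚ≥0) ≠ 0 :=
    div_ne_zero (by positivity) (by positivity)
  have hw : wOf φ₁ = wOf φ₂ := mul_right_cancel₀ hq hw'
  have hg : ModelFrobenioid.baseMap φ₁ = ModelFrobenioid.baseMap φ₂ := M.ext hu hn
  have hz : ModelFrobenioid.div φ₁ = ModelFrobenioid.div φ₂ := Subtype.ext (Multiplicative.toAdd.injective hw)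
  have h12 : (ModelFrobenioid.unit φ₁).1.2 = (ModelFrobenioid.unit φ₂).1.2 := by
    rw [unit_snd_eq, unit_snd_eq, hg, hd, hz]
  refine ModelFrobenioid.hom_ext hd hg hz (Subtype.ext (Prod.ext (Prod.ext ?_ ?_) h12))
  · exact Multiplicative.toAdd.injective hk
  · rw [unit_fst_snd_eq, unit_fst_snd_eq, h12]

/-- `swap` is faithful. [cite: MochizukiFrdI2008, Thm. 3.4 (iii) p.62] -/
instance : swap.Faithful where
  map_injective h := swap_faithful _ _ h

/-- The isomorphism `X₀ ≅ Y` = `(1, id, 0, ((0, ·), -cls(Y)))` (every object is isomorphic to `X₀`).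
[cite: MochizukiFrdI2008, Thm. 5.2 (ii) p.101] -/
def sHom (Y : C.category) : X₀ ⟶ Y := homOf X₀ Y 1 (𝟙 _) 1 0

/-- `sHom Y` is an isomorphism (linear, base-identity, isometric; `B` group-like). [cite: MochizukiFrdI2008, Thm. 5.2 (ii) p.101] -/
theorem isIso_sHom (Y : C.category) : IsIso (sHom Y) := by
  haveI : IsIso (ModelFrobenioid.baseMap (sHom Y)) := isIso_of_n_eq_one _ rfl
  exact ModelFrobenioid.isIso_of hBg _ rfl rfl

/-- `swap` is essentially surjective (every object is isomorphic to `X₀`). [cite: MochizukiFrdI2008, Thm. 5.2 (ii) p.101] -/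
instance : swap.EssSurj where
  mem_essImage Y := ⟨Y, ⟨@asIso _ _ _ _ (sHom Y) (isIso_sHom Y)⟩⟩

/-- **`swap` is a self-equivalence of `C`.** [cite: MochizukiFrdI2008, Thm. 3.4 (iii) p.62] -/
instance : swap.IsEquivalence where

/-- **Every typed hypothesis of Cor. 3.8 holds for `Ψ := swap : C ⥲ C`**: the base `B(ℤ ⋊ ℕ≥1)` is of FSM-, hence
FSMFF-type, and "non-dilating" reads `True` in the trivial vocabulary. [cite: MochizukiEtTh2009, Cor 3.8 p.80] -/
def hyp : Cor38Hyp C C where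
  Ψ := swap.asEquivalence
  fsmff := ⟨isOfFSMType.isOfFSMFFType, isOfFSMType.isOfFSMFFType⟩
  nonDilating := ⟨fun _ _ => trivial, fun _ _ => trivial⟩

/-! ### §2  Row F-2815 fails at `hyp` (and so does F-2812) -/

/-- The LINEAR endomorphism `φ₂ = (1, (0,2), 0, 0)` of `X₀` (degree `1`, base index `2`). [cite: MochizukiEtTh2009, Cor 3.8 p.81] -/
def φ₂ : X₀ ⟶ X₀ := mkEnd 1 ⟨0, 2⟩ 0 0

/-- `φ₂` is linear. [cite: MochizukiFrdI2008, Def. 1.2 (i) p.21] -/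
theorem isLinear_φ₂ : C.opsData.IsLinear φ₂ := rfl

/-- `swap φ₂ = (2, (0,1), 0, 0)` has Frobenius degree `2`: NOT linear. [cite: MochizukiFrdI2008, Def. 1.2 (i) p.21] -/
theorem not_isLinear_swap_φ₂ : ¬ C.opsData.IsLinear (swap.map φ₂) := fun h => by
  have h2 : (2 : ℕ+) = 1 := h
  exact absurd h2 (by decide)

/-- **Row F-2815 FAILS at `hyp`**: `Ψ = swap` does not carry linear morphisms to linear morphisms.
[cite: MochizukiEtTh2009, Cor 3.8 p.81] -/
theorem not_preservesLinear : ¬ hyp.PreservesLinear := fun h => not_isLinear_swap_φ₂ (h.1 φ₂ isLinear_φ₂)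

/-! The universal closure of F-2815 (universe `0`) is therefore FALSE; the closure theorem OF RECORD is abc-iut-f-133's
`Cor38Hyp.not_forall_preservesLinear` (`TemperedFrobenioidCor38SubLinearNegative.lean`, p455772, the same degree ↔ dilation
mechanism realised as an identity-on-objects involution), which this file does not restate: `not_preservesLinear` above is an
independent second witness at a different record (`DegreeSwap.hyp`, the collapse-to-`X₀` equivalence). -/

/-- The base-identity linear endomorphism `ℓ = (1, id, k = 1, w = 0)` of `X₀` — an element of `O^▷(X₀)` (indeed of
`O^×(X₀)`). [cite: MochizukiFrdI2008, Def. 1.2 (ii) p.22] -/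
def ℓ : X₀ ⟶ X₀ := mkEnd 1 ⟨0, 1⟩ 0 1

/-- `ℓ ∈ O^▷(X₀)`. [cite: MochizukiFrdI2008, Def. 1.2 (ii) p.22] -/
theorem ℓ_mem : (ℓ : End X₀) ∈ C.opsData.endSubmonoid X₀ := ⟨rfl, rfl⟩

/-- `swap ℓ = (1, (1,1), 0, 0)` is NOT a base-identity endomorphism. [cite: MochizukiFrdI2008, Def. 1.2 (ii) p.22] -/
theorem swap_ℓ_not_mem : (swap.map ℓ : End X₀) ∉ C.opsData.endSubmonoid X₀ := fun h => by
  have h1 : M.u (ModelFrobenioid.baseMap (swap.map ℓ)) = M.u (1 : M) := congrArg M.u h.1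
  exact absurd h1 (by decide)

/-- **Row F-2812 (`PreservesOTri`) also FAILS at `hyp`** — a second, independent witness (abc-iut-f-023's certificate via
[FrdI] Ex. 3.9 is the one of record). [cite: MochizukiEtTh2009, Cor 3.8 p.81] -/
theorem not_preservesOTri : ¬ hyp.PreservesOTri := fun h => swap_ℓ_not_mem (h.1 X₀ ℓ ℓ_mem)

end DegreeSwap

end Literature.AnabelianGeometry.EtaleTheta

end
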